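import Literature.Topology.FourManifolds.LeeRasmussenProofs
import Literature.Topology.FourManifolds.KhComplexQDegreeProofs
import Literature.Topology.FourManifolds.KhFaces
import Literature.Topology.FourManifolds.KhFlipReach
import HarnessLib

/-!
# Rasmussen's `s` of the flipped Gauss diagram: turning a knot diagram over keeps `s`

Sibling proof file of `LeeRasmussen.lean` (next to `LeeRasmussenProofs.lean`,
`LeeRasmussenReverseProofs.lean`). A knot `K ⊆ ℝ² × ℝ` drawn by the vertical projection may be
**turned over**: rotated by the angle `π` about a horizontal line of the projection plane,
`(a, y, h) ↦ (a, -y, -h)`. The rotated knot is isotopic to `K` (a rotation is isotopic to the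
identity) and is again in regular position; its Gauss diagram is obtained from the Gauss diagram
`G` of `K` by exchanging, at every chord, the over-passage and the under-passage (the heights are
negated) while **keeping all signs** (the plane curve is reflected, which negates the determinant
of the two tangent vectors, and the two rows of that determinant are exchanged, which negates it
again) and keeping the order of the marked points. We call this diagram `G.flip`
(`GaussDiagram.flip`; compare `GaussDiagram.mirror`, which also reverses every arrow but negates
the signs, and is the diagram of the mirror image).

* `GaussDiagram.rasmussenInvariant_flip` — **`s(G.flip) = s(G)`** for *every* (possibly virtual)
  Gauss diagram `G`.

This is an instance of the principle recorded in Rasmussen (2010), §2 and Khovanov (2000), §4.2,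
§7: the cube of resolutions of an oriented diagram, Lee's differential and the `q`-filtration are
built from the *unoriented chord structure* (which marked points are joined), the signs of the
crossings and the cyclic order of the marked points only. The direction of an arrow of a Gauss
diagram (which passage is *over*) enters the tree's construction (`KhResolutions`, `KhComplex`) at
exactly one place: the two local strands `arcIn (overPos i)`, `arcOut (overPos i)` at which merges,
splits and incidence numbers are read. Flipping the arrow reads them at the other end of the
chord, i.e. replaces the two local strands by the two strands glued to them (`KhFlipReach.flipFst`,
`flipSnd`), which lie on the same two state circles, possibly exchanged; and merges, splits and
incidence numbers are symmetric in the two local strands (commutativity and cocommutativity of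
the Frobenius algebra, `KhFace.mergeCoeff_comm`, `KhFace.splitCoeff_comm`), exactly as in the proof
of `rasmussenInvariant_reverse` (`LeeRasmussenReverseProofs.lean`). Hence the identity map of
enhanced states is an isomorphism of cubes preserving both gradings (`incidence_flipStates`,
`homDegree_flipStates`, `qDegree_flipStates`) and `rasmussenInvariant_eq_of_transport`
(`LeeRasmussenProofs.lean`, signs `ε = 1`) gives `s(G.flip) = s(G)`.

The geometric statement (the turned-over knot reads `G.flip`) is proved where it is used, in the
realisation of connected sums of diagrams (`ConnSumRealisation`); this file is pure combinatorics.

## References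

* J. Rasmussen, *Khovanov homology and the slice genus*, Invent. Math. 182 (2010) 419–447
  (arXiv:math/0402131), §2 (the cube of resolutions and Lee's complex), Def. 3.4.
  [cite: Rasmussen2010, §2]
* M. Khovanov, *A categorification of the Jones polynomial*, Duke Math. J. 101 (2000) 359–426,
  §4.2 (the cube complex), §7 (properties). [cite: Khovanov2000, §4.2]
* O. Viro, *Khovanov homology, its definitions and ramifications*, Fund. Math. 184 (2004)
  317–342, §5 (enhanced states of a Gauss diagram; incidence numbers, §5.2). [cite: Viro2004, §5]
* M. Goussarov, M. Polyak, O. Viro, *Finite-type invariants of classical and virtual knots*,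
  Topology 39 (2000), §1.2, §1.4 (arrows of a Gauss diagram; symmetries). [cite: GPV2000, §1.4]
* Tree: `LeeRasmussenProofs` (`rasmussenInvariant_eq_of_transport`, `leeSMax_eq_of_transport`,
  `incidence_of_update`, `incidence_eq_zero_of_not_exists`, `EnhancedState.ext'`),
  `KhComplexQDegreeProofs` (`EnhancedState.label_eq_of_circleOf_eq`, `circleOf_eq_iff`), `KhFaces`
  (`KhFace.mergeCoeff_comm`, `KhFace.splitCoeff_comm`), `KhFlipReach` (`flipFst`, `flipSnd`,
  `reachable_arcIn_flipFst`, `reachable_arcOut_flipSnd`, `isSeifert_update_self`), `KhResolutions`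
  (`IsMergeAt.not_isSplitAt_holds`).

## Design notes

No definitions of `Prop` type, no named facts, no `sorry`; the auxiliary definitions (`flip`,
`flipGraphIso`, `flipCircleEquiv`, `EnhancedState.flp`, `EnhancedState.unflp`, `flipStates`) are
concrete data with bodies. `G.flip` has the same number of chords as `G` *definitionally*, so its
positions, arcs and states are those of `G` and the transport maps are identities. Everything is
proved for abstract Gauss diagrams (no realisability hypothesis).
-/

open Function Set

noncomputable section

namespace Literature.Topology.FourManifolds

namespace GaussDiagram

variable (G : GaussDiagram)

/-! ## The flipped diagram: chords, marked points, signs -/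

/-- The **flip** of a Gauss diagram: every over-passage becomes an under-passage and conversely
(all arrows are reversed), the signs and the order of the marked points being **kept**. It is the
Gauss diagram of the same knot turned over (rotated by `π` about a horizontal line of the
projection plane), see the module docstring; compare `GaussDiagram.mirror` (arrows reversed *and*
signs negated: the mirror image). GPV (2000), §1.2 (arrows), §1.4. [cite: GPV2000, §1.4] -/
def flip : GaussDiagram where
  n := G.n
  overPos := G.underPos
  underPos := G.overPos
  sign := G.sign
  bijective := by
    have h : Sum.elim G.underPos G.overPos = Sum.elim G.overPos G.underPos ∘ Sum.swap := by
      ext x; cases x <;> rfl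
    rw [h]
    exact G.bijective.comp (_root_.Equiv.sumComm _ _).bijective

/-- The flip keeps the number of chords (definitionally). [folklore] -/
@[simp] theorem flip_n : G.flip.n = G.n := rfl

/-- The over-passages of the flip are the under-passages. [folklore] -/
theorem flip_overPos (i : Fin G.n) : G.flip.overPos i = G.underPos i := rfl

/-- The under-passages of the flip are the over-passages. [folklore] -/
theorem flip_underPos (i : Fin G.n) : G.flip.underPos i = G.overPos i := rfl

/-- The flip keeps the signs. [folklore] -/
@[simp] theorem flip_sign : G.flip.sign = G.sign := rfl

/-- Flipping twice gives back the diagram. [folklore] -/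
@[simp] theorem flip_flip : G.flip.flip = G := by
  cases G; rfl

/-- The flip keeps the writhe. [folklore] -/
@[simp] theorem writhe_flip : G.flip.writhe = G.writhe := rfl

/-- The flip keeps the number of positive crossings. [folklore] -/
@[simp] theorem nPlus_flip : G.flip.nPlus = G.nPlus := rfl

/-- The flip keeps the number of negative crossings. [folklore] -/
@[simp] theorem nMinus_flip : G.flip.nMinus = G.nMinus := rfl

/-- The chord through a marked point is the same in the flip. [folklore] -/
@[simp] theorem chordOf_flip (p : Fin (2 * G.n)) : G.flip.chordOf p = G.chordOf p := by
  obtain ⟨i, rfl | rfl⟩ := G.exists_chord p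
  · rw [chordOf_overPos, ← flip_underPos, chordOf_underPos]
  · rw [chordOf_underPos, ← flip_overPos, chordOf_overPos]

/-- The partner of a marked point is the same in the flip. [folklore] -/
@[simp] theorem partner_flip (p : Fin (2 * G.n)) : G.flip.partner p = G.partner p := by
  obtain ⟨i, rfl | rfl⟩ := G.exists_chord p
  · rw [partner_overPos, ← flip_underPos, partner_underPos, flip_overPos]
  · rw [partner_underPos, ← flip_overPos, partner_overPos, flip_underPos]

/-- The flip keeps the Seifert rule (same chords, same signs, same states). [folklore] -/
@[simp] theorem isSeifert_flip (σ : G.State) (i : Fin G.n) :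
    G.flip.isSeifert σ i = G.isSeifert σ i := rfl

/-- The flip keeps the Gauss parity condition `overPos i ≢ underPos i (mod 2)` (it is symmetric in
the two ends of a chord). Kauffman (1999), §3.2. [folklore] -/
theorem flip_parity_iff :
    (∀ i, (G.flip.overPos i).val % 2 ≠ (G.flip.underPos i).val % 2) ↔
      ∀ i, (G.overPos i).val % 2 ≠ (G.underPos i).val % 2 :=
  forall_congr' fun _ ↦ ⟨fun h ↦ Ne.symm h, fun h ↦ Ne.symm h⟩

/-! ## Arcs, reconnection relation and state circles of the flip -/

/-- The flip keeps the number of arcs (definitionally). [folklore] -/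
theorem arcCount_flip : G.flip.arcCount = G.arcCount := rfl

/-- The arc entering a marked point is the same arc in the flip. [folklore] -/
theorem flip_arcIn (p : Fin (2 * G.n)) : G.flip.arcIn p = G.arcIn p := rfl

/-- The arc leaving a marked point is the same arc in the flip. [folklore] -/
theorem flip_arcOut (p : Fin (2 * G.n)) : G.flip.arcOut p = G.arcOut p := rfl

/-- **The flip keeps the reconnection relation of every state**: the relation is built from the
unordered chords (`chordOf`, `partner`), the Seifert rule and the arcs at marked points, none of
which sees the direction of the arrows. Viro (2004), §2, §5. [cite: Viro2004, §2] -/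
theorem stateAdj_flip (σ : G.State) (a b : G.Arc) :
    G.flip.stateAdj σ a b ↔ G.stateAdj σ a b := by
  unfold stateAdj
  simp only [chordOf_flip, partner_flip, isSeifert_flip, flip_arcIn, flip_arcOut, flip_n]
  exact Iff.rfl

/-- The flip keeps the state graph of every state. [folklore] -/
theorem stateGraph_flip (σ : G.State) : G.flip.stateGraph σ = G.stateGraph σ := by
  ext a b
  simp only [stateGraph, SimpleGraph.fromRel_adj, ne_eq, stateAdj_flip]
  exact Iff.rfl

/-- The identity of arcs as an isomorphism from the state graph of `σ` in `G` to the state graph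
of `σ` in `G.flip`. [folklore] -/
def flipGraphIso (σ : G.State) : G.stateGraph σ ≃g G.flip.stateGraph σ where
  toEquiv := _root_.Equiv.refl _
  map_rel_iff' := by
    intro a b
    rw [stateGraph_flip]
    rfl

/-- The isomorphism of state graphs is the identity on arcs. [folklore] -/
@[simp] theorem flipGraphIso_apply (σ : G.State) (a : G.Arc) : G.flipGraphIso σ a = a := rfl

/-- The induced bijection of state circles under the flip. [folklore] -/
def flipCircleEquiv (σ : G.State) : G.StateCircle σ ≃ G.flip.StateCircle σ :=
  (G.flipGraphIso σ).connectedComponentEquiv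

/-- The bijection of state circles sends the circle of an arc to the circle of the same arc.
[folklore] -/
@[simp] theorem flipCircleEquiv_circleOf (σ : G.State) (a : G.Arc) :
    G.flipCircleEquiv σ (G.circleOf σ a) = G.flip.circleOf σ a := rfl

/-- Two arcs lie on the same state circle of the flip iff they do in the diagram. [folklore] -/
theorem circleOf_flip_eq_iff (σ : G.State) (a b : G.Arc) :
    G.flip.circleOf σ a = G.flip.circleOf σ b ↔ G.circleOf σ a = G.circleOf σ b := by
  rw [← flipCircleEquiv_circleOf, ← flipCircleEquiv_circleOf, (G.flipCircleEquiv σ).injective.eq_iff]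

/-! ## The flip of enhanced states -/

variable {G}

/-- The **flipped enhanced state**: the same state and the same labels, read in `G.flip`.
Viro (2004), §5.1. [cite: Viro2004, §5.1] -/
def EnhancedState.flp (s : G.EnhancedState) : G.flip.EnhancedState where
  state := s.state
  label := s.label
  label_eq a b hab := s.label_eq a b ((G.flipGraphIso s.state).map_rel_iff.1 hab)

/-- The inverse of the flip of enhanced states. [folklore] -/
def EnhancedState.unflp (u : G.flip.EnhancedState) : G.EnhancedState where
  state := u.state
  label := u.label
  label_eq a b hab := u.label_eq a b ((G.flipGraphIso u.state).map_rel_iff.2 hab)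

/-- The state of the flipped enhanced state. [folklore] -/
@[simp] theorem EnhancedState.flp_state (s : G.EnhancedState) : s.flp.state = s.state := rfl

/-- The labels of the flipped enhanced state. [folklore] -/
@[simp] theorem EnhancedState.flp_label (s : G.EnhancedState) : s.flp.label = s.label := rfl

/-- The state of the back-flipped enhanced state. [folklore] -/
@[simp] theorem EnhancedState.unflp_state (u : G.flip.EnhancedState) : u.unflp.state = u.state := rfl

/-- The labels of the back-flipped enhanced state. [folklore] -/
@[simp] theorem EnhancedState.unflp_label (u : G.flip.EnhancedState) : u.unflp.label = u.label := rfl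

variable (G) in
/-- **The flip is a bijection of enhanced states** (the identity on states and labels).
Khovanov (2000), §4.2; Viro (2004), §5.1. [cite: Viro2004, §5.1] -/
def flipStates : G.EnhancedState ≃ G.flip.EnhancedState where
  toFun := EnhancedState.flp
  invFun := EnhancedState.unflp
  left_inv _ := EnhancedState.ext' rfl rfl
  right_inv _ := EnhancedState.ext' rfl rfl

/-- The bijection of enhanced states is `EnhancedState.flp`. [folklore] -/
@[simp] theorem flipStates_apply (s : G.EnhancedState) : G.flipStates s = s.flp := rfl

/-- The flip preserves the homological degree (same state, same `n₋`). Bar-Natan (2002), §3.2.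
[cite: BarNatan2002, §3.2] -/
theorem homDegree_flipStates (s : G.EnhancedState) : homDegree (G.flipStates s) = homDegree s := rfl

/-- The bijection of state circles matches the circles carrying a given label. [folklore] -/
theorem card_filter_label_flp (s : G.EnhancedState) (b : Bool) :
    (Finset.univ.filter fun c' : G.flip.StateCircle s.flp.state ↦
        ∃ a', G.flip.circleOf s.flp.state a' = c' ∧ s.flp.label a' = b).card =
      (Finset.univ.filter fun c : G.StateCircle s.state ↦
        ∃ a, G.circleOf s.state a = c ∧ s.label a = b).card := by
  symm
  refine Finset.card_equiv (G.flipCircleEquiv s.state) fun c ↦ ?_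
  simp only [Finset.mem_filter, Finset.mem_univ, true_and]
  constructor
  · rintro ⟨a, rfl, hb⟩
    exact ⟨a, rfl, hb⟩
  · rintro ⟨a', ha', hb⟩
    exact ⟨a', (G.flipCircleEquiv s.state).injective (by rw [flipCircleEquiv_circleOf]; exact ha'), hb⟩

/-- The flip preserves the quantum degree. Bar-Natan (2002), §3.2. [cite: BarNatan2002, §3.2] -/
theorem qDegree_flipStates (s : G.EnhancedState) : qDegree (G.flipStates s) = qDegree s := by
  rw [flipStates_apply]
  unfold qDegree
  rw [card_filter_label_flp s false, card_filter_label_flp s true]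
  rfl

/-! ## The two local strands at a chord, read from either end -/

variable (G)

/-- The local strands of the flip at chord `i` are the arcs at the under-passage. [folklore] -/
theorem flip_arcIn_overPos (i : Fin G.n) : G.flip.arcIn (G.flip.overPos i) = G.arcIn (G.underPos i) :=
  rfl

/-- The local strands of the flip at chord `i` are the arcs at the under-passage. [folklore] -/
theorem flip_arcOut_overPos (i : Fin G.n) : G.flip.arcOut (G.flip.overPos i) = G.arcOut (G.underPos i) :=
  rfl

/-- In every state, the arc entering the under-passage of chord `i` lies on the state circle of
one of the two local strands at the over-passage: on that of `arcOut (overPos i)` if the smoothing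
at `i` is Seifert's (`arcIn (underPos i)` is then glued to `arcOut (overPos i)`), on that of
`arcIn (overPos i)` otherwise. Viro (2004), §5.2. [cite: Viro2004, §5.2] -/
theorem circleOf_arcIn_underPos (σ : G.State) (i : Fin G.n) :
    G.circleOf σ (G.arcIn (G.underPos i)) =
      if G.isSeifert σ i = true then G.circleOf σ (G.arcOut (G.overPos i))
      else G.circleOf σ (G.arcIn (G.overPos i)) := by
  have h1 := G.reachable_arcIn_flipFst σ i
  have h2 := G.reachable_arcOut_flipSnd σ i
  unfold flipFst at h1
  unfold flipSnd at h2
  cases hS : G.isSeifert σ i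
  · simp only [hS, Bool.false_eq_true, if_false] at h1 ⊢
    exact (circleOf_eq_iff.2 h1).symm
  · simp only [hS, if_true] at h2 ⊢
    exact (circleOf_eq_iff.2 h2).symm

/-- In every state, the arc leaving the under-passage of chord `i` lies on the state circle of
`arcIn (overPos i)` if the smoothing at `i` is Seifert's, on that of `arcOut (overPos i)` otherwise.
Viro (2004), §5.2. [cite: Viro2004, §5.2] -/
theorem circleOf_arcOut_underPos (σ : G.State) (i : Fin G.n) :
    G.circleOf σ (G.arcOut (G.underPos i)) =
      if G.isSeifert σ i = true then G.circleOf σ (G.arcIn (G.overPos i))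
      else G.circleOf σ (G.arcOut (G.overPos i)) := by
  have h1 := G.reachable_arcIn_flipFst σ i
  have h2 := G.reachable_arcOut_flipSnd σ i
  unfold flipFst at h1
  unfold flipSnd at h2
  cases hS : G.isSeifert σ i
  · simp only [hS, Bool.false_eq_true, if_false] at h2 ⊢
    exact (circleOf_eq_iff.2 h2).symm
  · simp only [hS, if_true] at h1 ⊢
    exact (circleOf_eq_iff.2 h1).symm

/-- The two strands at the under-passage lie on different state circles iff the two strands at the
over-passage do (they lie on the same two circles, possibly exchanged). [folklore] -/
theorem circleOf_underPos_ne_iff (σ : G.State) (i : Fin G.n) :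
    G.circleOf σ (G.arcIn (G.underPos i)) ≠ G.circleOf σ (G.arcOut (G.underPos i)) ↔
      G.circleOf σ (G.arcIn (G.overPos i)) ≠ G.circleOf σ (G.arcOut (G.overPos i)) := by
  rw [circleOf_arcIn_underPos, circleOf_arcOut_underPos]
  split_ifs
  · exact ne_comm
  · exact Iff.rfl

/-! ## Merges, splits and incidence numbers of the flip -/

/-- Merges of the flipped diagram are the merges of the diagram. Viro (2004), §5.2.
[cite: Viro2004, §5.2] -/
theorem isMergeAt_flip (σ : G.State) (i : Fin G.n) : G.flip.IsMergeAt σ i ↔ G.IsMergeAt σ i := by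
  unfold IsMergeAt
  exact and_congr Iff.rfl
    ((G.circleOf_flip_eq_iff σ (G.arcIn (G.underPos i)) (G.arcOut (G.underPos i))).not.trans
      (G.circleOf_underPos_ne_iff σ i))

/-- Splits of the flipped diagram are the splits of the diagram. Viro (2004), §5.2.
[cite: Viro2004, §5.2] -/
theorem isSplitAt_flip (σ : G.State) (i : Fin G.n) : G.flip.IsSplitAt σ i ↔ G.IsSplitAt σ i := by
  unfold IsSplitAt
  exact and_congr Iff.rfl
    ((G.circleOf_flip_eq_iff (Function.update σ i true) (G.arcIn (G.underPos i))
        (G.arcOut (G.underPos i))).not.trans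
      (G.circleOf_underPos_ne_iff (Function.update σ i true) i))

variable {G}

/-- After a merge at chord `i` all four arcs at the chord lie on one state circle. Viro (2004),
§5. [cite: Viro2004, §5] -/
theorem circleOf_update_eq_of_isMergeAt' {σ : G.State} {i : Fin G.n} (h : G.IsMergeAt σ i) :
    G.circleOf (Function.update σ i true) (G.arcIn (G.overPos i)) =
        G.circleOf (Function.update σ i true) (G.arcOut (G.overPos i)) ∧
      G.circleOf (Function.update σ i true) (G.arcIn (G.underPos i)) =
        G.circleOf (Function.update σ i true) (G.arcIn (G.overPos i)) ∧
      G.circleOf (Function.update σ i true) (G.arcOut (G.underPos i)) =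
        G.circleOf (Function.update σ i true) (G.arcIn (G.overPos i)) := by
  have hab : G.circleOf (Function.update σ i true) (G.arcIn (G.overPos i)) =
      G.circleOf (Function.update σ i true) (G.arcOut (G.overPos i)) := by
    by_contra hne
    exact IsMergeAt.not_isSplitAt_holds h ⟨h.1, hne⟩
  refine ⟨hab, ?_, ?_⟩
  · rw [circleOf_arcIn_underPos]
    split_ifs
    · exact hab.symm
    · rfl
  · rw [circleOf_arcOut_underPos]
    split_ifs
    · rfl
    · exact hab.symm

/-- Before a split at chord `i` (which is not a merge) all four arcs at the chord lie on one state
circle. Viro (2004), §5. [cite: Viro2004, §5] -/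
theorem circleOf_eq_of_not_isMergeAt' {σ : G.State} {i : Fin G.n} (hi : σ i = false)
    (h : ¬ G.IsMergeAt σ i) :
    G.circleOf σ (G.arcIn (G.overPos i)) = G.circleOf σ (G.arcOut (G.overPos i)) ∧
      G.circleOf σ (G.arcIn (G.underPos i)) = G.circleOf σ (G.arcIn (G.overPos i)) ∧
      G.circleOf σ (G.arcOut (G.underPos i)) = G.circleOf σ (G.arcIn (G.overPos i)) := by
  have hab : G.circleOf σ (G.arcIn (G.overPos i)) = G.circleOf σ (G.arcOut (G.overPos i)) := by
    by_contra hne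
    exact h ⟨hi, hne⟩
  refine ⟨hab, ?_, ?_⟩
  · rw [circleOf_arcIn_underPos]
    split_ifs
    · exact hab.symm
    · rfl
  · rw [circleOf_arcOut_underPos]
    split_ifs
    · rfl
    · exact hab.symm

/-- **Incidence numbers are invariant under the flip**: for every Frobenius system
`R[X]/(X² - hX - t)` and all enhanced states `s`, `s'` of `G`, `⟨d s.flp, s'.flp⟩ = ⟨d s, s'⟩`.
The flipped chord and the Koszul sign are the same; the two local strands are read at the other
end of the chord, where they are glued to the strands at this end (same two circles, possibly
exchanged), which does not matter since the multiplication is commutative, the comultiplication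
cocommutative, and all four arcs carry the same label after a merge and before a split.
Viro (2004), §5.2; Khovanov (2000), §4.2. [cite: Viro2004, §5.2] -/
theorem incidence_flipStates {R : Type} [CommRing R] (h t : R) (s s' : G.EnhancedState) :
    G.flip.incidence R h t (G.flipStates s) (G.flipStates s') = G.incidence R h t s s' := by
  by_cases hex : ∃ i, s.state i = false ∧ s'.state = Function.update s.state i true
  swap
  · rw [incidence_eq_zero_of_not_exists (s := G.flipStates s) (s' := G.flipStates s') h t hex,
      incidence_eq_zero_of_not_exists h t hex]
  obtain ⟨i, hi, hs'⟩ := hex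
  rw [flipStates_apply, flipStates_apply, incidence_of_update h t (s := s.flp) (s' := s'.flp) hi hs',
    incidence_of_update h t hi hs']
  have hM := G.isMergeAt_flip s.state i
  have hS := G.isSplitAt_flip s.state i
  simp only [EnhancedState.flp_state] at hM hS ⊢
  rw [flip_arcIn_overPos, flip_arcOut_overPos]
  simp only [EnhancedState.flp_label]
  -- the label conditions, read in the flip
  have hcond : ∀ (σ : G.State) (x : G.Arc),
      (∀ c', G.flip.circleOf σ c' ≠ G.flip.circleOf σ x → s'.label c' = s.label c') ↔
      (∀ c, G.circleOf σ c ≠ G.circleOf σ x → s'.label c = s.label c) := fun σ x ↦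
    forall_congr' fun c ↦ imp_congr_left (G.circleOf_flip_eq_iff σ c x).not
  -- the Koszul sign of the flip is that of `G`
  have hedge : ∀ σ : G.State, (G.flip.edgeSign σ i : R) = (G.edgeSign σ i : R) := fun σ ↦ rfl
  by_cases h1 : G.IsMergeAt s.state i
  · -- merge: after the flip all four arcs lie on one circle, so their labels in `s'` agree, and
    -- before it the two strands at the under-passage lie on the circles of the two strands at the
    -- over-passage (exchanged or not)
    obtain ⟨-, ha'a, -⟩ :
        G.circleOf s'.state (G.arcIn (G.overPos i)) = G.circleOf s'.state (G.arcOut (G.overPos i)) ∧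
          G.circleOf s'.state (G.arcIn (G.underPos i)) = G.circleOf s'.state (G.arcIn (G.overPos i)) ∧
          G.circleOf s'.state (G.arcOut (G.underPos i)) = G.circleOf s'.state (G.arcIn (G.overPos i)) := by
      rw [hs']; exact circleOf_update_eq_of_isMergeAt' h1
    have hiff : (∀ c, G.circleOf s'.state c ≠ G.circleOf s'.state (G.arcIn (G.underPos i)) →
          s'.label c = s.label c) ↔
        (∀ c, G.circleOf s'.state c ≠ G.circleOf s'.state (G.arcIn (G.overPos i)) →
          s'.label c = s.label c) := by rw [ha'a]
    rw [if_pos h1, if_pos (hM.2 h1)]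
    by_cases h2 : ∀ c, G.circleOf s'.state c ≠ G.circleOf s'.state (G.arcIn (G.overPos i)) →
        s'.label c = s.label c
    · rw [if_pos h2, if_pos ((hcond s'.state _).2 (hiff.2 h2)), s'.label_eq_of_circleOf_eq ha'a, hedge]
      have hin : mergeCoeff R h t (s.label (G.arcIn (G.underPos i))) (s.label (G.arcOut (G.underPos i)))
            (s'.label (G.arcIn (G.overPos i))) =
          mergeCoeff R h t (s.label (G.arcIn (G.overPos i))) (s.label (G.arcOut (G.overPos i)))
            (s'.label (G.arcIn (G.overPos i))) := by
        have e1 := G.circleOf_arcIn_underPos s.state i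
        have e2 := G.circleOf_arcOut_underPos s.state i
        split_ifs at e1 e2 with hsf
        · rw [s.label_eq_of_circleOf_eq e1, s.label_eq_of_circleOf_eq e2, KhFace.mergeCoeff_comm]
        · rw [s.label_eq_of_circleOf_eq e1, s.label_eq_of_circleOf_eq e2]
      rw [hin]
    · rw [if_neg h2, if_neg (mt (fun H ↦ hiff.1 ((hcond s'.state _).1 H)) h2)]
  · rw [if_neg h1, if_neg (mt hM.1 h1)]
    by_cases h3 : G.IsSplitAt s.state i
    · -- split: before the flip all four arcs lie on one circle, so their labels in `s` agree, and
      -- after it the two strands at the under-passage lie on the circles of the two strands at the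
      -- over-passage (exchanged or not)
      obtain ⟨-, ha'a, -⟩ := circleOf_eq_of_not_isMergeAt' hi h1
      have hiff : (∀ c, G.circleOf s.state c ≠ G.circleOf s.state (G.arcIn (G.underPos i)) →
            s'.label c = s.label c) ↔
          (∀ c, G.circleOf s.state c ≠ G.circleOf s.state (G.arcIn (G.overPos i)) →
            s'.label c = s.label c) := by rw [ha'a]
      rw [if_pos h3, if_pos (hS.2 h3)]
      by_cases h4 : ∀ c, G.circleOf s.state c ≠ G.circleOf s.state (G.arcIn (G.overPos i)) →
          s'.label c = s.label c
      · rw [if_pos h4, if_pos ((hcond s.state _).2 (hiff.2 h4)), s.label_eq_of_circleOf_eq ha'a, hedge]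
        have hout : splitCoeff R h t (s.label (G.arcIn (G.overPos i))) (s'.label (G.arcIn (G.underPos i)))
              (s'.label (G.arcOut (G.underPos i))) =
            splitCoeff R h t (s.label (G.arcIn (G.overPos i))) (s'.label (G.arcIn (G.overPos i)))
              (s'.label (G.arcOut (G.overPos i))) := by
          have e1 := G.circleOf_arcIn_underPos s'.state i
          have e2 := G.circleOf_arcOut_underPos s'.state i
          split_ifs at e1 e2 with hsf
          · rw [s'.label_eq_of_circleOf_eq e1, s'.label_eq_of_circleOf_eq e2, KhFace.splitCoeff_comm]
          · rw [s'.label_eq_of_circleOf_eq e1, s'.label_eq_of_circleOf_eq e2]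
        rw [hout]
      · rw [if_neg h4, if_neg (mt (fun H ↦ hiff.1 ((hcond s.state _).1 H)) h4)]
    · rw [if_neg h3, if_neg (mt hS.1 h3)]

/-! ## `s_max` and `s` of the flipped diagram -/

variable (G)

/-- **`s_max` of a Gauss diagram does not depend on the direction of its arrows** (signs kept):
`s_max(G.flip) = s_max(G)`. The flip of enhanced states is an isomorphism of the cubes of
resolutions preserving both gradings (`incidence_flipStates`, `homDegree_flipStates`,
`qDegree_flipStates`), hence a filtered isomorphism of Lee complexes (`leeSMax_eq_of_transport`,
signs `ε = 1`). Rasmussen (2010), §2, Def. 3.1. [cite: Rasmussen2010, §2] -/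
theorem leeSMax_flip : G.flip.leeSMax = G.leeSMax :=
  leeSMax_eq_of_transport G.flipStates homDegree_flipStates (fun _ ↦ 1) qDegree_flipStates
    (fun _ ↦ by norm_num) fun s s' ↦ by rw [incidence_flipStates]; ring

/-- **Rasmussen's `s` of a Gauss diagram does not depend on the direction of its arrows** (signs
kept): `s(G.flip) = s(G)` for every Gauss diagram `G`, where `G.flip` is the diagram of the same
knot turned over (rotated by `π` about a horizontal line of the projection plane). Lee's complex
with its filtration uses the arrows of a Gauss diagram only through the unordered chords and the
signs. Rasmussen (2010), §2, Def. 3.4; Khovanov (2000), §4.2; Viro (2004), §5.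
[cite: Rasmussen2010, §2] -/
theorem rasmussenInvariant_flip : G.flip.rasmussenInvariant = G.rasmussenInvariant :=
  rasmussenInvariant_eq_of_transport G.flipStates homDegree_flipStates (fun _ ↦ 1) qDegree_flipStates
    (fun _ ↦ by norm_num) fun s s' ↦ by rw [incidence_flipStates]; ring

end GaussDiagram

end Literature.Topology.FourManifolds
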